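import Summits.Schanuel.Schanuel.Theorems.ZilberEacDriftingTransversal
import Summits.Schanuel.Schanuel.Theorems.ZilberEacInvariantDriftExistence
import Summits.Schanuel.Schanuel.Theorems.ZilberEacInvariantDirectionDensity
import Summits.Schanuel.Schanuel.Theorems.ZilberEacExplosionDominance
import HarnessLib

/-!
# Invariant bases with NON-proportional degrees: Zariski density via THEOREM L″

Zilber's Exponential-Algebraic Closedness, case ladder (host summit Schanuel, cell `pub-schanuel`,
seat 2, gen 11).  `W = polyFibredGraph g A F` over a base invariant under the lattice direction `q`
(`g(x + zq) = g(x)`), targets with `(Aⱼ)_{dⱼ}(2πiq) ≠ 0` but degree vector `d = (dⱼ)` NOT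
proportional to `q`: the solution families of `ZilberEacInvariantDriftExistence` escape along `q`
(`y_m = 2πi m`), their transversal part drifts like `(log m) d` towards the limits
`ρ_p = 2πi p + log a` (`p ∈ ℤ^{s+1}`, a translate of `2πiℤ^{s+1}`: Zariski dense by
`exists_int_eval_translate_ne_zero` — NO transversal condition is needed), and the power coordinate
`e^{g}` decays super-polynomially when `Re g_D(d) < 0`.  THEOREM L″
(`ZilberEacDriftingTransversal.unprojectedDense_of_drifting_transversal`) concludes
(`‖y_m‖/τ_m^k = 2πm/(log m)^k → ∞` from `Real.tendsto_pow_log_div_mul_add_atTop`).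

**THEOREM (`unprojectedDense_polyFibredGraph_invariantDrift`).**  `g` invariant under `q`,
`deg g ≥ 2`, `(Aⱼ)_{dⱼ}(2πiq) ≠ 0`, `Re g_D(d) < 0`, `Fⱼ ∈ ℂ[u, x]` ARBITRARY ⟹ `I(W ∩ Γ_exp) = I(W)`.
Certified members (`polyFibredGraph_invariantDrift_member_dense`); example in `EC(3,2)`:
**`negSqDiff_drift_member_dense`** — `{x₂ = -(x₀ - x₁)², y₀ = x₀ + x₁² + y₂, y₁ = x₁ + y₂}`
(`d = (2,1)`, `q = (1,1)`, `g_D(d) = -1`): outside the balance theorem (`g_D(1,1) = 0`), the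
puncture/oscillatory theorems (no negative ray) and gen 11's proportional-degree theorem
(`d ∦ q`) — dense.

HONEST FRAMING: explicit families inside an OPEN cell (periodic sub-cell: existence is cheap,
DENSITY is the content); `EC(3,2)` OPEN; NOT Schanuel's conjecture; EAC ⇏ SC.
-/

noncomputable section

open Complex MvPolynomial Filter Topology
open Literature.NumberTheory.Transcendental Literature.ModelTheory.Zilber
  Literature.ModelTheory.ExponentialFields

set_option linter.dupNamespace false

namespace Summit.Schanuel.Schanuel.Theorems

section Drift

variable {s : ℕ}

/-- **THEOREM (density, invariant base, non-proportional degrees).**  See the module docstring.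
(new) [cite: MantovaMasser2023, §1 p.5 (the open case dim π(V) = 2 in ℂ³×ℂˣ³)] -/
theorem unprojectedDense_polyFibredGraph_invariantDrift (g : MvPolynomial (Fin (s + 1)) ℂ)
    (hD : 2 ≤ g.totalDegree) (q : Fin (s + 1) → ℤ)
    (hper : ∀ (x : Fin (s + 1) → ℂ) (z : ℂ), eval (x + z • fun j => (q j : ℂ)) g = eval x g)
    (A : Fin (s + 1) → MvPolynomial (Fin (s + 1)) ℂ)
    (hA : ∀ j, eval (fun i => 2 * Real.pi * I * (q i : ℂ))
      (homogeneousComponent (A j).totalDegree (A j)) ≠ 0)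
    (hneg : (eval (fun j => (((A j).totalDegree : ℕ) : ℂ))
      (homogeneousComponent g.totalDegree g)).re < 0)
    (F : Fin (s + 1) → MvPolynomial (Fin (s + 2)) ℂ) :
    UnprojectedDense (polyFibredGraph g A F) := by
  classical
  set L : Fin (s + 1) → ℂ := fun j => log (eval (fun i => 2 * Real.pi * I * (q i : ℂ))
    (homogeneousComponent (A j).totalDegree (A j))) with hL
  refine unprojectedDense_of_drifting_transversal (t := s + 1)
    (isIrreducibleClosed_polyFibredGraph g A F) (by rw [zariskiDim_polyFibredGraph])
    (fun i => Sum.inl (Fin.castSucc i)) (Sum.inr (Fin.last (s + 1)))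
    (fun j => (((A j).totalDegree : ℕ) : ℂ)) (fun j => (q j : ℂ))
    (U := {ρ | ∃ p : Fin (s + 1) → ℤ, ρ = fun j => 2 * Real.pi * I * (p j : ℂ) + L j})
    (fun G hG => ?_) ?_
  · obtain ⟨pv, hpv⟩ := exists_int_eval_translate_ne_zero hG L (a := 2 * Real.pi * I)
      Complex.two_pi_I_ne_zero
    refine ⟨_, ⟨pv, rfl⟩, ?_⟩
    have e : (fun j => 2 * Real.pi * I * (pv j : ℂ) + L j) = fun i => L i + 2 * Real.pi * I * (pv i : ℂ) := by
      funext i; ring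
    rwa [e]
  rintro ρ ⟨p, rfl⟩
  obtain ⟨x, r, hsol, hxr, hgr, hr, hdec⟩ :=
    exists_solutions_invariantDrift g hD q hper A hA hneg F p
  set P : ℕ → Fin (s + 2) ⊕ Fin (s + 2) → ℂ := fun m => pgParam g A F (x m) (exp (eval (x m) g))
    with hP
  have hnormy : ∀ m : ℕ, ‖(2 * Real.pi * I * (m : ℂ) : ℂ)‖ = 2 * Real.pi * m := fun m => by
    rw [show (2 * Real.pi * I * (m : ℂ) : ℂ) = ((2 * Real.pi * (m : ℝ) : ℝ) : ℂ) * I by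
      push_cast; ring, norm_mul, Complex.norm_I, mul_one, Complex.norm_real, Real.norm_eq_abs,
      abs_of_nonneg (by positivity)]
  refine ⟨P, r, fun m => Real.log m, fun m => 2 * Real.pi * I * (m : ℂ), ?_, ?_, ?_, ?_, hr, ?_, ?_⟩
  · filter_upwards [hsol] with m hm
    exact ⟨pgParam_mem g A F _ _, pgParam_mem_expGraph_of_solution g A F hm⟩
  · filter_upwards with m
    have hcoord : (fun i => P m (Sum.inl (Fin.castSucc i))) = x m := by
      funext i; simp [hP]
    rw [hcoord, hxr m]
  · filter_upwards with m
    simp only [hP, pgParam_inr, pMulParam_last]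
    exact Complex.exp_ne_zero _
  · exact Real.tendsto_log_atTop.comp tendsto_natCast_atTop_atTop
  · intro k
    -- `m / (log m)^k → +∞` (no Mathlib lemma under this exact name in our imports)
    have hdiv : Tendsto (fun m : ℕ => (m : ℝ) / Real.log m ^ k) atTop atTop := by
      have h0 : Tendsto (fun m : ℕ => Real.log (m : ℝ) ^ k / (1 * (m : ℝ) + 0)) atTop (𝓝 0) :=
        (Real.tendsto_pow_log_div_mul_add_atTop 1 0 k one_ne_zero).comp tendsto_natCast_atTop_atTop
      have hpos : ∀ᶠ m : ℕ in atTop, 0 < Real.log (m : ℝ) ^ k / (1 * (m : ℝ) + 0) := by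
        filter_upwards [eventually_gt_atTop 2] with m hm
        have hm' : (1 : ℝ) < m := by exact_mod_cast (show 1 < m by omega)
        have : 0 < Real.log (m : ℝ) := Real.log_pos hm'
        positivity
      have h1 : Tendsto (fun m : ℕ => Real.log (m : ℝ) ^ k / (1 * (m : ℝ) + 0)) atTop (𝓝[>] 0) :=
        tendsto_nhdsWithin_iff.2 ⟨h0, hpos⟩
      refine (h1.inv_tendsto_nhdsGT_zero).congr' ?_
      filter_upwards with m
      simp only [Pi.inv_apply, one_mul, add_zero, inv_div]
    have h := hdiv.const_mul_atTop Real.two_pi_pos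
    refine h.congr fun m => ?_
    rw [hnormy, mul_div_assoc]
  · intro N
    filter_upwards [hdec N] with m hm
    simp only [hP, pgParam_inr, pMulParam_last]
    exact hm

/-- **Certified members with dense exponential points (invariant base, drifting degrees).**
`A` dominant, `deg g ≥ 2`, the hypotheses of the theorem: all seven hypotheses of
`ECCell (s+2) (s+1)`, not linearly split, `W ∩ Γ_exp ≠ ∅`, `I(W ∩ Γ_exp) = I(W)`. (new)
[cite: MantovaMasser2023, §1 p.5 (the open case dim π(V) = 2 in ℂ³×ℂˣ³)] -/
theorem polyFibredGraph_invariantDrift_member_dense (g : MvPolynomial (Fin (s + 1)) ℂ)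
    (hD : 2 ≤ g.totalDegree) (q : Fin (s + 1) → ℤ)
    (hper : ∀ (x : Fin (s + 1) → ℂ) (z : ℂ), eval (x + z • fun j => (q j : ℂ)) g = eval x g)
    (A : Fin (s + 1) → MvPolynomial (Fin (s + 1)) ℂ)
    (hAinj : Function.Injective
      (aeval A : MvPolynomial (Fin (s + 1)) ℂ →ₐ[ℂ] MvPolynomial (Fin (s + 1)) ℂ))
    (hA : ∀ j, eval (fun i => 2 * Real.pi * I * (q i : ℂ))
      (homogeneousComponent (A j).totalDegree (A j)) ≠ 0)
    (hneg : (eval (fun j => (((A j).totalDegree : ℕ) : ℂ))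
      (homogeneousComponent g.totalDegree g)).re < 0)
    (F : Fin (s + 1) → MvPolynomial (Fin (s + 2)) ℂ) :
    (IsIrreducibleClosed ℂ (polyFibredGraph g A F) ∧
      (polyFibredGraph g A F ∩ torusLocus ℂ (s + 2)).Nonempty ∧
      IsRotund ℂ (s + 2) (polyFibredGraph g A F ∩ torusLocus ℂ (s + 2)) ∧
      IsAddFree ℂ (s + 2) (polyFibredGraph g A F ∩ torusLocus ℂ (s + 2)) ∧
      IsMulFree ℂ (s + 2) (polyFibredGraph g A F ∩ torusLocus ℂ (s + 2)) ∧
      zariskiDim ℂ (polyFibredGraph g A F) = (s + 2 : ℕ) ∧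
      addProjDim ℂ (s + 2) (polyFibredGraph g A F) = (s + 1 : ℕ)) ∧
    ¬ IsLinearSplit ℂ (s + 2) (polyFibredGraph g A F) ∧
    (polyFibredGraph g A F ∩ expGraph ℂ (s + 2)).Nonempty ∧
    UnprojectedDense (polyFibredGraph g A F) := by
  have hcell := ecCell_hypotheses_polyFibredGraph g A F hAinj hD
  have hdense := unprojectedDense_polyFibredGraph_invariantDrift g hD q hper A hA hneg F
  refine ⟨hcell, not_isLinearSplit_polyFibredGraph g A _ (Nat.succ_pos s) hAinj, ?_, hdense⟩
  obtain ⟨w, hw, -⟩ := hcell.2.1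
  exact inter_expGraph_nonempty_of_vanishingIdeal_eq ⟨w, hw⟩ hdense

end Drift

/-! ## Example in `EC(3,2)`: `x₂ = -(x₀ - x₁)²`, `y₀ = x₀ + x₁² + y₂`, `y₁ = x₁ + y₂` -/

section Example

/-- The triangular target map `(X₀ + X₁², X₁)` is injective (left inverse `(X₀ - X₁², X₁)`).
[folklore] -/
theorem aeval_triangular_injective :
    Function.Injective (aeval (![X 0 + X 1 ^ 2, X 1] : Fin 2 → MvPolynomial (Fin 2) ℂ) :
      MvPolynomial (Fin 2) ℂ →ₐ[ℂ] MvPolynomial (Fin 2) ℂ) := by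
  have hcomp : (aeval (![X 0 - X 1 ^ 2, X 1] : Fin 2 → MvPolynomial (Fin 2) ℂ)).comp
      (aeval (![X 0 + X 1 ^ 2, X 1] : Fin 2 → MvPolynomial (Fin 2) ℂ)) =
      AlgHom.id ℂ (MvPolynomial (Fin 2) ℂ) := by
    refine MvPolynomial.algHom_ext fun i => ?_
    rw [AlgHom.comp_apply, AlgHom.id_apply, aeval_X]
    fin_cases i
    · simp [map_add, map_pow]
    · simp
  intro f₁ f₂ h
  have := congrArg (aeval (![X 0 - X 1 ^ 2, X 1] : Fin 2 → MvPolynomial (Fin 2) ℂ)) h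
  rwa [← AlgHom.comp_apply, ← AlgHom.comp_apply, hcomp, AlgHom.id_apply, AlgHom.id_apply] at this

/-- **An invariant-base member of `EC(3,2)` with non-proportional degrees is dense**:
`W = {x₂ = -(x₀ - x₁)², y₀ = x₀ + x₁² + y₂, y₁ = x₁ + y₂} ⊆ ℂ³ × ℂ³`
(`e^z = z + w² + e^{-(z-w)²}`, `e^w = w + e^{-(z-w)²}`): degrees `d = (2,1)` along the invariant
direction `q = (1,1)`, `g_D(d) = -1 < 0`: all seven hypotheses of `ECCell 3 2`, not linearly split,
`W ∩ Γ_exp ≠ ∅` AND `I(W ∩ Γ_exp) = I(W)`. (new)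
[cite: MantovaMasser2023, §1 p.5 (the open case dim π(V) = 2 in ℂ³×ℂˣ³)] -/
theorem negSqDiff_drift_member_dense :
    (IsIrreducibleClosed ℂ (polyFibredGraph (-(X 0 - X 1) ^ 2 : MvPolynomial (Fin 2) ℂ)
        ![X 0 + X 1 ^ 2, X 1] (fun _ => 1)) ∧
      (polyFibredGraph (-(X 0 - X 1) ^ 2 : MvPolynomial (Fin 2) ℂ) ![X 0 + X 1 ^ 2, X 1] (fun _ => 1) ∩
        torusLocus ℂ 3).Nonempty ∧
      IsRotund ℂ 3 (polyFibredGraph (-(X 0 - X 1) ^ 2 : MvPolynomial (Fin 2) ℂ) ![X 0 + X 1 ^ 2, X 1]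
        (fun _ => 1) ∩ torusLocus ℂ 3) ∧
      IsAddFree ℂ 3 (polyFibredGraph (-(X 0 - X 1) ^ 2 : MvPolynomial (Fin 2) ℂ) ![X 0 + X 1 ^ 2, X 1]
        (fun _ => 1) ∩ torusLocus ℂ 3) ∧
      IsMulFree ℂ 3 (polyFibredGraph (-(X 0 - X 1) ^ 2 : MvPolynomial (Fin 2) ℂ) ![X 0 + X 1 ^ 2, X 1]
        (fun _ => 1) ∩ torusLocus ℂ 3) ∧
      zariskiDim ℂ (polyFibredGraph (-(X 0 - X 1) ^ 2 : MvPolynomial (Fin 2) ℂ) ![X 0 + X 1 ^ 2, X 1]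
        (fun _ => 1)) = (3 : ℕ) ∧
      addProjDim ℂ 3 (polyFibredGraph (-(X 0 - X 1) ^ 2 : MvPolynomial (Fin 2) ℂ) ![X 0 + X 1 ^ 2, X 1]
        (fun _ => 1)) = (2 : ℕ)) ∧
    ¬ IsLinearSplit ℂ 3 (polyFibredGraph (-(X 0 - X 1) ^ 2 : MvPolynomial (Fin 2) ℂ)
        ![X 0 + X 1 ^ 2, X 1] (fun _ => 1)) ∧
    (polyFibredGraph (-(X 0 - X 1) ^ 2 : MvPolynomial (Fin 2) ℂ) ![X 0 + X 1 ^ 2, X 1] (fun _ => 1) ∩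
        expGraph ℂ 3).Nonempty ∧
    UnprojectedDense (polyFibredGraph (-(X 0 - X 1) ^ 2 : MvPolynomial (Fin 2) ℂ)
        ![X 0 + X 1 ^ 2, X 1] (fun _ => 1)) := by
  obtain ⟨hdeg, hper, -, -, -⟩ := negSqDiff_data
  set g : MvPolynomial (Fin 2) ℂ := -(X 0 - X 1) ^ 2 with hg
  have hhom : g.IsHomogeneous 2 := ((isHomogeneous_X ℂ 0).sub (isHomogeneous_X ℂ 1)).pow 2 |>.neg
  have heval : ∀ x : Fin 2 → ℂ, eval x g = -(x 0 - x 1) ^ 2 := fun x => by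
    simp [hg, map_sub, map_pow, eval_X]
  -- the targets: `A₀ = X₀ + X₁²` (degree 2, leading form `X₁²`), `A₁ = X₁` (degree 1)
  have hX1sq : (X 1 ^ 2 : MvPolynomial (Fin 2) ℂ).IsHomogeneous 2 := isHomogeneous_X_pow 1 2
  have hcomp2 : homogeneousComponent 2 (X 0 + X 1 ^ 2 : MvPolynomial (Fin 2) ℂ) = X 1 ^ 2 := by
    rw [map_add, homogeneousComponent_of_mem ((mem_homogeneousSubmodule _ _).2 (isHomogeneous_X ℂ 0)),
      if_neg (by norm_num), homogeneousComponent_eq_self hX1sq, zero_add]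
  have hdeg2 : (X 0 + X 1 ^ 2 : MvPolynomial (Fin 2) ℂ).totalDegree = 2 := by
    apply le_antisymm
    · refine (totalDegree_add _ _).trans (max_le ?_ ?_)
      · rw [totalDegree_X]; norm_num
      · rw [totalDegree_X_pow]
    · by_contra hlt
      rw [not_le] at hlt
      have h0 := homogeneousComponent_eq_zero _ _ hlt
      rw [hcomp2] at h0
      exact pow_ne_zero 2 (X_ne_zero (1 : Fin 2)) h0
  have hA : ∀ j : Fin 2, eval (fun i => 2 * Real.pi * I * (((![1, 1] : Fin 2 → ℤ) i : ℂ)))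
      (homogeneousComponent ((![X 0 + X 1 ^ 2, X 1] : Fin 2 → MvPolynomial (Fin 2) ℂ) j).totalDegree
        ((![X 0 + X 1 ^ 2, X 1] : Fin 2 → MvPolynomial (Fin 2) ℂ) j)) ≠ 0 := by
    refine Fin.forall_fin_two.2 ⟨?_, ?_⟩
    · have e : (![X 0 + X 1 ^ 2, X 1] : Fin 2 → MvPolynomial (Fin 2) ℂ) 0 = X 0 + X 1 ^ 2 := rfl
      rw [e, hdeg2, hcomp2]
      simp [map_pow, eval_X, Real.pi_ne_zero, Complex.I_ne_zero]
    · have e : (![X 0 + X 1 ^ 2, X 1] : Fin 2 → MvPolynomial (Fin 2) ℂ) 1 = X 1 := rfl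
      rw [e, totalDegree_X, homogeneousComponent_eq_self (isHomogeneous_X ℂ 1), eval_X]
      simp [Real.pi_ne_zero, Complex.I_ne_zero]
  -- the drift vector `d = (2, 1)` and `Re g_D(d) = -1 < 0`
  have hd1 : (X 1 : MvPolynomial (Fin 2) ℂ).totalDegree = 1 := totalDegree_X _
  have hdvec : (fun j : Fin 2 => ((((![X 0 + X 1 ^ 2, X 1] : Fin 2 → MvPolynomial (Fin 2) ℂ) j).totalDegree : ℕ) : ℂ)) =
      ![(2 : ℂ), 1] := by
    funext j
    refine Fin.cases ?_ (fun i => ?_) j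
    · have e : (![X 0 + X 1 ^ 2, X 1] : Fin 2 → MvPolynomial (Fin 2) ℂ) 0 = X 0 + X 1 ^ 2 := rfl
      simp only [e, hdeg2, Matrix.cons_val_zero]; norm_num
    · have hi : i = 0 := Subsingleton.elim _ _
      subst hi
      have e : (![X 0 + X 1 ^ 2, X 1] : Fin 2 → MvPolynomial (Fin 2) ℂ) (Fin.succ 0) = X 1 := rfl
      have e2 : (![(2 : ℂ), 1] : Fin 2 → ℂ) (Fin.succ 0) = 1 := rfl
      rw [e, e2, hd1]; norm_num
  have hneg : (eval (fun j : Fin 2 => ((((![X 0 + X 1 ^ 2, X 1] : Fin 2 → MvPolynomial (Fin 2) ℂ) j).totalDegree : ℕ) : ℂ))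
      (homogeneousComponent g.totalDegree g)).re < 0 := by
    rw [hdvec, hdeg, homogeneousComponent_eq_self hhom, heval]
    simp only [Matrix.cons_val_zero, Matrix.cons_val_one, Matrix.cons_val_fin_one]
    norm_num
  exact polyFibredGraph_invariantDrift_member_dense g (by rw [hdeg]) ![1, 1] hper _
    aeval_triangular_injective hA hneg _

end Example

end Summit.Schanuel.Schanuel.Theorems

end
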